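import Literature.Computability.FineGrained.NSETHNonReducibility
import Literature.Computability.FineGrained.CliqueETHMachineModel
import Literature.Computability.Cryptography.WordRAMToTM2Oracle
import HarnessLib

/-!
# NSETH and the non-reducibility of CNF-SAT to 3SUM: the change of machine model (discharge)

This file discharges the named fact
`Literature.Computability.FineGrained.sparseKSATInExpTime_of_cnfSATInThreeSumOracleRAMTime`
(`NSETHNonReducibility.lean`, step 2 of the decomposition of **fine-grained.S20**, Carmosino et al.,
ITCS 2016, Thm. 3): for `c ≥ 2` and `ρ ≥ 0`, a deterministic word-RAM *oracle* program deciding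
`CNFSATWithSize c` with the canonical 3SUM oracle in `⌊C 2^{ρ n} + C⌋₊` steps at word size
`k · inputWidth` yields, for all `k'`, all densities `c'` and all `η > 0`, a multi-stack Turing
machine deciding the `k'`-CNFs with at most `c' n` clauses in time `2^{(ρ+η) n} · poly(L)`
(`SparseKSATInExpTime k' c' (ρ + η)`).

This is the folklore simulation of random-access machines by multitape Turing machines with
polynomial overhead **per step** (Cook–Reckhow 1973, §2), assembled from the verified pieces of the
tree, along the lines of the qualitative (ETH-granularity) version `CliqueETHMachineModel.lean`:

* the input transducer `LightSearch.exists_recode_machine` and the token loop `KCNFToRAM.mainLoop`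
  with the header routines `hdrE01`, `hdrE23`, `hdrE45` (`KCNFToWordRAMInput.lean`);
* **new here**: `bumpN N` (the header `n` becomes `n + N`: the clause list handed to the RAM is
  padded with the tautological clause `x_{n+N-1} ∨ ¬x_{n+N-1}`, an instance of `CNFSATWithSize 2`
  on exactly `n + N` variables for `N = (k'+1) c' + 3`), `widthRuler k` (the ruler of the *exact*
  word size `k · inputWidth x`, computed as `k` copies of the unary maximum of the numeral lengths
  of `|x|` and of `2(n+N) - 1`, `inputWidth_eq`), the interpreter with 3SUM queries and
  duplicate-free memory log `WordRAM.ToTM2.interpQ` (`WordRAMToTM2Oracle.lean`, cost linear in the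
  number of simulated steps), `readOutBit`, `cleanup`;
* the compilation of structured stack programs to `FinTM2` and the sequential composition of TM2
  machines.

The time analysis is in one variable `Z = κ (L + 1)(n + 1)` raised to a power depending on `k`:
every simulated step costs `O(Z₁⁵)` for `Z₁ = O(Z^k)` (`stepCostQ_le_pow`; the value bound
`V = max (2^W - 1) (maxConst M)` is a polynomial in `n` and `L` because `W = k · inputWidth x` and
`2^{inputWidth x} ≤ 2 (max |x| (2(n+N)-1)) + 1`), the number of steps is at most
`⌊C 2^{ρ (n+N)} + C⌋₊`, and `poly(n) ≤ C_η 2^{η n}`.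

The case `k = 0` (word size `0`) is degenerate: the initial memory of the RAM is then identically
`0` whatever the input, so the hypothesis — a correct answer on a satisfiable and on an
unsatisfiable instance with the same run — is contradictory (`not_cnfSAT_ram_zero`).

## References

* S. A. Cook, R. A. Reckhow, *Time bounded random access machines*, JCSS 7 (1973) 354–375, §2.
* M. L. Carmosino, J. Gao, R. Impagliazzo, I. Mihajlin, R. Paturi, S. Schneider, ITCS 2016, §3
  Lemma 1, §5 Thm. 3.
* V. Vassilevska Williams, *On some fine-grained questions in algorithms and complexity*,
  Proc. ICM 2018, §2 (word RAM with `O(log n)`-bit words, Def. 2.1).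
* R. Impagliazzo, R. Paturi, F. Zane, JCSS 63 (2001), §2 (sparse instances).
-/

namespace Literature.Computability.FineGrained

open _root_.Computability Turing Complexity Complexity.Com Cryptography Cryptography.WordRAM
open Cryptography.WordRAM.ToTM2 Cryptography.WordRAM.ToTM2.St Cryptography.KCNFToRAM LightSearch
open SparseSatBridge

namespace NSETHBridge

variable {k : ℕ}

/-! ### The padded clause list on `n + N` variables -/

/-- The clause list handed to the word RAM: the clauses of `φ` preceded by the tautological clause
`x_{n+N-1} ∨ ¬x_{n+N-1}`. [folklore] -/
def paddedN (N : ℕ) (φ : KCNF k) : CNF ℕ := padClause (φ.numVars + N) :: φ.clauses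

/-- The padded clause list has one more clause. [folklore] -/
theorem numClauses_paddedN (N : ℕ) (φ : KCNF k) : CNF.numClauses (paddedN N φ) = φ.clauses.length + 1 := rfl

/-- The padded clause list has exactly `n + N` variables in the sense of `CNF.numVars` (`N ≥ 1`).
[folklore] -/
theorem numVars_paddedN {N : ℕ} (hN : 1 ≤ N) (φ : KCNF k) : CNF.numVars (paddedN N φ) = φ.numVars + N := by
  have hrest : (List.map (fun l : ℕ × Bool => l.1 + 1) φ.clauses.flatten).foldr max 0 ≤ φ.numVars := by
    refine foldr_max_zero_le fun x hx => ?_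
    obtain ⟨l, hl, rfl⟩ := List.mem_map.1 hx
    obtain ⟨c, hc, hlc⟩ := List.mem_flatten.1 hl
    exact φ.fst_lt_numVars c hc l hlc
  have e : CNF.numVars (paddedN N φ) = max (φ.numVars + N - 1 + 1) (max (φ.numVars + N - 1 + 1)
      ((List.map (fun l : ℕ × Bool => l.1 + 1) φ.clauses.flatten).foldr max 0)) := rfl
  rw [e]
  omega

/-- The size of the padded clause list. [folklore] -/
theorem size_paddedN (N : ℕ) (φ : KCNF k) : CNF.size (paddedN N φ) = (φ.clauses.map List.length).sum + 2 := by
  simp [CNF.size, paddedN, padClause]; omega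

/-- The padding clause is a tautology: the padded clause list is satisfiable iff `φ` is. [folklore] -/
theorem satisfiable_paddedN_iff (N : ℕ) (φ : KCNF k) : CNF.Satisfiable (paddedN N φ) ↔ φ.Satisfiable := by
  rw [KCNF.satisfiable_iff_exists_eval]
  simp only [CNF.Satisfiable, kcnf_eval_eq, paddedN, CNF.eval, List.all_cons, Bool.and_eq_true]
  refine exists_congr fun σ => ?_
  have : (padClause (φ.numVars + N)).any (Literal.eval σ) = true := by
    cases h : σ (φ.numVars + N - 1) <;> simp [padClause, Literal.eval, h]
  simp [this]

/-- **The padded clause list of a sparse `k`-CNF is an instance of `CNFSATWithSize 2`** for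
`N = (k + 1) c + 3`: `numClauses + size ≤ (k + 1) c n + 3 ≤ (n + N + 1)²`. [folklore] -/
theorem numClauses_add_size_paddedN_le {c : ℕ} (φ : KCNF k) (hsp : φ.clauses.length ≤ c * φ.numVars) :
    CNF.numClauses (paddedN ((k + 1) * c + 3) φ) + CNF.size (paddedN ((k + 1) * c + 3) φ) ≤
      (CNF.numVars (paddedN ((k + 1) * c + 3) φ) + 1) ^ 2 := by
  rw [numVars_paddedN (by omega), numClauses_paddedN, size_paddedN]
  set n := φ.numVars
  have hsum : (φ.clauses.map List.length).sum ≤ φ.clauses.length * k := by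
    have := List.sum_le_card_nsmul (φ.clauses.map List.length) k (by
      intro x hx
      obtain ⟨cl, hcl, rfl⟩ := List.mem_map.1 hx
      exact φ.length_le cl hcl)
    simpa using this
  have h1 : (φ.clauses.map List.length).sum ≤ c * n * k := hsum.trans (Nat.mul_le_mul_right _ hsp)
  set M := (k + 1) * c + 4 with hM
  have e1 : n + ((k + 1) * c + 3) + 1 = n + M := by omega
  have h2 : c * n + c * n * k = c * n * (k + 1) := by ring
  have h3 : c * n * (k + 1) ≤ n * M := by rw [hM]; nlinarith
  have h4 : (n + M) * M ≤ (n + M) ^ 2 := by rw [pow_two]; exact Nat.mul_le_mul_left _ (Nat.le_add_left _ _)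
  have h5 : (n + M) * M = n * M + M * M := by ring
  have h6 : 16 ≤ M * M := Nat.mul_le_mul (show 4 ≤ M by omega) (show 4 ≤ M by omega)
  rw [e1]
  omega

/-! ### The memory image and its width -/

/-- Without empty clauses, the word list written by the front end on the header `n + N` is
`|x| :: x` for the `CNFSAT` input `x = encodeCNFWords (paddedN N φ)` (`N ≥ 1`). [folklore] -/
theorem wordsOf_paddedN {N : ℕ} (hN : 1 ≤ N) (φ : KCNF k) (h0 : [] ∉ φ.clauses) :
    wordsOf (φ.numVars + N) (formulaOf φ) =
      (encodeCNFWords (paddedN N φ)).length :: encodeCNFWords (paddedN N φ) := by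
  rw [wordsOf, filter_ne_nil_formulaOf φ h0, length_formulaOf, dataWords_formulaOf φ h0,
    encodeCNFWords_eq', numVars_paddedN hN, numClauses_paddedN]
  simp [hdrWords, paddedN, padClause, clauseData]
  all_goals omega

/-- The largest word of the image: `max |x| (2(n+N) - 1)`. [folklore] -/
def maxWord (N : ℕ) (φ : KCNF k) : ℕ := max (encodeCNFWords (paddedN N φ)).length (2 * (φ.numVars + N) - 1)

/-- Every word of `encodeCNFWords (paddedN N φ)` is at most `maxWord N φ` (`N ≥ 1`). [folklore] -/
theorem le_maxWord_of_mem {N : ℕ} (hN : 1 ≤ N) (φ : KCNF k) {v : ℕ} (hv : v ∈ encodeCNFWords (paddedN N φ)) :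
    v ≤ maxWord N φ := by
  unfold maxWord
  have hnv := numVars_paddedN hN φ
  set x := encodeCNFWords (paddedN N φ) with hx
  -- the length of `x` dominates the clause count and the clause lengths
  have hlen : x.length = 2 + ((paddedN N φ).map fun c => c.length + 1).sum := by
    rw [hx, encodeCNFWords]
    simp only [List.length_cons, List.length_flatMap, List.length_map]
    omega
  have hcl : ∀ c ∈ paddedN N φ, c.length + 1 ≤ ((paddedN N φ).map fun c => c.length + 1).sum := fun c hc =>
    List.single_le_sum (fun _ _ => Nat.zero_le _) _ (List.mem_map.2 ⟨c, hc, rfl⟩)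
  have hcount : (paddedN N φ).length ≤ ((paddedN N φ).map fun c => c.length + 1).sum := by
    have := List.card_nsmul_le_sum ((paddedN N φ).map fun c => c.length + 1) 1 (by
      intro y hy; obtain ⟨c, -, rfl⟩ := List.mem_map.1 hy; omega)
    simp only [List.length_map, smul_eq_mul, mul_one] at this
    exact this
  rw [hx, encodeCNFWords] at hv
  simp only [List.mem_cons, List.mem_flatMap, List.mem_map] at hv
  rcases hv with rfl | rfl | ⟨c, hc, rfl | ⟨l, hl, rfl⟩⟩
  · rw [hnv]; omega
  · simp only [CNF.numClauses]; omega
  · have := hcl c hc; omega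
  · -- a literal: of the padding clause, or of `φ`
    simp only [paddedN, List.mem_cons] at hc
    rcases hc with rfl | hc
    · simp only [padClause, List.mem_cons, List.not_mem_nil, or_false] at hl
      rcases hl with rfl | rfl <;> simp <;> omega
    · have := φ.fst_lt_numVars c hc l hl
      have hb : l.2.toNat ≤ 1 := Bool.toNat_le l.2
      omega

/-- `foldr max 1` is bounded by any common bound `≥ 1` of the entries. [folklore] -/
theorem foldr_max_one_le {l : List ℕ} {B : ℕ} (h : ∀ v ∈ l, v ≤ B) (hB : 1 ≤ B) : l.foldr max 1 ≤ B := by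
  induction l with
  | nil => exact hB
  | cons a l ih =>
    rw [List.foldr_cons]
    exact max_le (h a (by simp)) (ih fun v hv => h v (by simp [hv]))

/-- Every entry is at most `foldr max 1`. [folklore] -/
theorem le_foldr_max_one_of_mem {l : List ℕ} {m : ℕ} (h : m ∈ l) : m ≤ l.foldr max 1 := by
  induction l with
  | nil => simp at h
  | cons a l ih =>
    rw [List.foldr_cons]
    rcases List.mem_cons.1 h with rfl | h
    · exact le_max_left _ _
    · exact le_trans (ih h) (le_max_right _ _)

/-- **The input width of the image** is the bit size of `maxWord` (`N ≥ 1`: the padding literal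
`x_{n+N-1}` has the largest code `2(n+N) - 1`, every other word is at most `|x|`). [folklore] -/
theorem inputWidth_eq_size_maxWord {N : ℕ} (hN : 1 ≤ N) (φ : KCNF k) :
    inputWidth (encodeCNFWords (paddedN N φ)) = Nat.size (maxWord N φ) := by
  unfold inputWidth maxWord
  congr 1
  set x := encodeCNFWords (paddedN N φ) with hx
  apply le_antisymm
  · refine max_le (le_max_left _ _) ?_
    exact foldr_max_one_le (B := maxWord N φ) (fun v hv => le_maxWord_of_mem hN φ hv) (by unfold maxWord; omega)
  · refine max_le (le_max_left _ _) (le_trans (le_foldr_max_one_of_mem ?_) (le_max_right _ _))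
    -- the padding literal `2(n+N-1)+1 = 2(n+N)-1` occurs in `x`
    have e : 2 * (φ.numVars + N) - 1 = 2 * (φ.numVars + N - 1, true).1 + (φ.numVars + N - 1, true).2.toNat := by
      simp; omega
    rw [hx, e]
    exact List.mem_cons_of_mem _ (List.mem_cons_of_mem _ (List.mem_flatMap.2 ⟨padClause (φ.numVars + N),
      List.mem_cons_self, List.mem_cons_of_mem _ (List.mem_map.2 ⟨(φ.numVars + N - 1, true), by simp [padClause], rfl⟩)⟩))

/-- The input width as the larger of the numeral lengths of `|x|` and of `2(n+N) - 1`. [folklore] -/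
theorem inputWidth_eq {N : ℕ} (hN : 1 ≤ N) (φ : KCNF k) :
    inputWidth (encodeCNFWords (paddedN N φ)) =
      max (encodeNat (encodeCNFWords (paddedN N φ)).length).length (encodeNat (2 * (φ.numVars + N) - 1)).length := by
  rw [inputWidth_eq_size_maxWord hN, TM2Pass.length_encodeNat_eq_size, TM2Pass.length_encodeNat_eq_size, maxWord]
  rcases le_total (encodeCNFWords (paddedN N φ)).length (2 * (φ.numVars + N) - 1) with h | h
  · rw [max_eq_right h, max_eq_right (Nat.size_le_size h)]
  · rw [max_eq_left h, max_eq_left (Nat.size_le_size h)]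

/-- `2^{|encodeNat m|} ≤ 2 m + 1` (the numeral length is the bit size; `2^{size m - 1} ≤ m` for
`m ≥ 1`). [folklore] -/
theorem two_pow_length_encodeNat_le (m : ℕ) : 2 ^ (encodeNat m).length ≤ 2 * m + 1 := by
  rw [TM2Pass.length_encodeNat_eq_size]
  rcases Nat.eq_zero_or_pos m with rfl | hm
  · simp
  · have hs : 0 < m.size := Nat.size_pos.2 hm
    have h : 2 ^ (m.size - 1) ≤ m := Nat.lt_size.1 (Nat.sub_lt hs Nat.one_pos)
    have h2 : 2 ^ m.size = 2 * 2 ^ (m.size - 1) := by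
      rw [← Nat.pow_succ']; congr 1; omega
    omega

/-- **The word size is logarithmic**: `2^{inputWidth x} ≤ 2 maxWord + 1`. [folklore] -/
theorem two_pow_inputWidth_le {N : ℕ} (hN : 1 ≤ N) (φ : KCNF k) :
    2 ^ inputWidth (encodeCNFWords (paddedN N φ)) ≤ 2 * maxWord N φ + 1 := by
  rw [inputWidth_eq_size_maxWord hN, ← TM2Pass.length_encodeNat_eq_size]
  exact two_pow_length_encodeNat_le _

/-- The numeral of an odd number is one bit longer than that of its half. [folklore] -/
theorem length_encodeNat_two_mul_add_one (v : ℕ) : (encodeNat (2 * v + 1)).length = (encodeNat v).length + 1 := by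
  have hn := norm_cons_encodeNat true v
  simp only [Bool.toNat_true] at hn
  have hcanon : norm (true :: encodeNat v) = true :: encodeNat v := by
    refine eq_of_bitsToNat_eq_of_canonical _ _ (norm_eq_nil_or_getLast _) ?_ (by simp [norm_eq_encodeNat])
    rcases encodeNat_canonical v with h | ⟨w, hw⟩
    · exact Or.inr ⟨[], by rw [h]; rfl⟩
    · exact Or.inr ⟨true :: w, by rw [hw]; rfl⟩
  rw [← hn, hcanon, List.length_cons]

/-! ### The header on `n + N` variables -/

/-- `incrN N`: `N` increments of the bank register `x`. [folklore] -/
def incrN : ℕ → Com (K ⊕ AReg)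
  | 0 => skip
  | N + 1 => incrN N ;; incr (Sum.inr AReg.x) (Sum.inr AReg.s) (Sum.inr AReg.t) (Sum.inr AReg.f)

/-- Effect of `incrN N`: `x := x + N` on canonical numerals, cost `N (9 |encodeNat (x + N)| + 14)`.
[folklore] -/
theorem runs_incrN (ρ : St) (y z u g : List Bool) : ∀ (N v : ℕ),
    Runs (incrN N) (state ρ (AReg.file (encodeNat v) y z [] [] u [] g))
      (state ρ (AReg.file (encodeNat (v + N)) y z [] [] u [] g)) (N * (9 * (encodeNat (v + N)).length + 14))
  | 0, v => (Runs.skip _).of_eq (by simp) (by simp)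
  | N + 1, v => by
    have h1 := runs_incrN ρ y z u g N v
    have h2 := h1.seq (runs_incr (B := (Sum.inr AReg.x : K ⊕ AReg)) (t := Sum.inr AReg.s) (t2 := Sum.inr AReg.t)
      (fl := Sum.inr AReg.f) (by simp) (by simp) (by simp) (by simp) (by simp) (by simp) _ (by simp) (by simp) (by simp))
    simp only [Sum.elim_inr, AReg.file_x, Sum.update_elim_inr, AReg.update_file_x, ← TokConv.encodeNat_succ_eq_incRes] at h2
    rw [show v + N + 1 = v + (N + 1) by omega] at h2
    refine h2.of_eq rfl ?_
    have hl : (encodeNat (v + N)).length ≤ (encodeNat (v + (N + 1))).length := Brick.length_encodeNat_mono (by omega)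
    have e : (N + 1) * (9 * (encodeNat (v + (N + 1))).length + 14) =
        N * (9 * (encodeNat (v + (N + 1))).length + 14) + (9 * (encodeNat (v + (N + 1))).length + 14) := by ring
    have hm : N * (9 * (encodeNat (v + N)).length + 14) ≤ N * (9 * (encodeNat (v + (N + 1))).length + 14) :=
      Nat.mul_le_mul_left _ (by omega)
    rw [e]; omega

/-- `bumpN N`: replace the reversed header numeral of `n` on `nrev`, `nrev2` by that of `n + N`
(through the bank: pour, `N` increments, copy, two pours). [folklore] -/
def bumpN (N : ℕ) : Com (K ⊕ AReg) :=
  ((((pour (Sum.inl K.nrev2) (Sum.inr AReg.x) ;; clear (Sum.inl K.nrev)) ;; incrN N) ;;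
    copy (Sum.inr AReg.x) (Sum.inl K.lit) (Sum.inl K.tmp) (Sum.inr AReg.s)) ;; pour (Sum.inr AReg.x) (Sum.inl K.nrev)) ;;
    pour (Sum.inl K.lit) (Sum.inl K.nrev2)

/-- **Effect of `bumpN`** at the end of the token pass: the header numeral becomes that of `n + N`.
[folklore] -/
theorem runs_bumpN (A m T n N : ℕ) (e : Bool) (E : List (List Bool × List Bool)) :
    Runs (bumpN N)
      (state { St.zero with
        nrev := (encodeNat n).reverse, nrev2 := (encodeNat n).reverse, tokc := ones T
        adr := encodeNat A, mc := encodeNat m, he := flag e, mem := encLog E } F0)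
      (state { St.zero with
        nrev := (encodeNat (n + N)).reverse, nrev2 := (encodeNat (n + N)).reverse, tokc := ones T
        adr := encodeNat A, mc := encodeNat m, he := flag e, mem := encLog E } F0)
      ((9 * N + 21) * (encodeNat (n + N)).length + 14 * N + 7) := by
  have hl : (encodeNat n).length ≤ (encodeNat (n + N)).length := Brick.length_encodeNat_mono (by omega)
  have c1 := runs_pour (a := (Sum.inl K.nrev2 : K ⊕ AReg)) (b := Sum.inr AReg.x) (by simp)
    (state { St.zero with
        nrev := (encodeNat n).reverse, nrev2 := (encodeNat n).reverse, tokc := ones T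
        adr := encodeNat A, mc := encodeNat m, he := flag e, mem := encLog E } F0)
  have c2 := c1.seq (runs_clear (Sum.inl K.nrev : K ⊕ AReg) _)
  simp only [state, Sum.elim_inl, regs_nrev2, List.reverse_reverse, Sum.elim_inr, F0, AReg.file_x, List.append_nil,
    Sum.update_elim_inl, update_regs_nrev2, Sum.update_elim_inr, AReg.update_file_x, regs_nrev, update_regs_nrev,
    List.length_reverse] at c2
  have c3 := c2.seq (runs_incrN _ [] [] [] [] N n)
  have c4 := c3.seq (runs_copy (a := (Sum.inr AReg.x : K ⊕ AReg)) (b := Sum.inl K.lit) (t := Sum.inl K.tmp)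
    (u := Sum.inr AReg.s) (by simp) (by simp) (by simp) (by simp) (by simp) (by simp) _ (by simp [St.zero]) (by simp))
  simp only [Sum.elim_inr, AReg.file_x, Sum.elim_inl, regs_lit, Sum.update_elim_inl, update_regs_lit] at c4
  have c5 := c4.seq (runs_pour (a := (Sum.inr AReg.x : K ⊕ AReg)) (b := Sum.inl K.nrev) (by simp) _)
  simp only [Sum.elim_inr, AReg.file_x, Sum.elim_inl, regs_nrev, Sum.update_elim_inr, AReg.update_file_x,
    Sum.update_elim_inl, update_regs_nrev] at c5
  have c6 := c5.seq (runs_pour (a := (Sum.inl K.lit : K ⊕ AReg)) (b := Sum.inl K.nrev2) (by simp) _)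
  simp only [Sum.elim_inl, regs_lit, regs_nrev2, Sum.update_elim_inl, update_regs_lit, update_regs_nrev2] at c6
  refine c6.of_eq ?_ ?_
  · simp [state, St.zero, F0]
  · simp only [St.zero, List.append_nil]
    nlinarith [hl]

/-! ### The ruler of the exact word size -/

section Generic

variable {ι : Type} [DecidableEq ι]

/-- `toUnary a b`: pop `a` bit by bit, pushing a `1` on `b` for each bit. [folklore] -/
def toUnary (a b : ι) : Com ι := loop a (push b true) (push b true)

/-- Effect of `toUnary`: `b := 1^{|a|} ++ b`, `a` emptied, cost `3 |a| + 1`. [folklore] -/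
theorem runs_toUnary {a b : ι} (hab : a ≠ b) : ∀ (w : List Bool) (R : Regs ι), R a = w →
    Runs (toUnary a b) R (Function.update (Function.update R a []) b (ones w.length ++ R b)) (3 * w.length + 1)
  | [], R, hR => by
    refine (Runs.loop_nil _ _ hR).of_eq ?_ (by simp)
    ext i : 1
    simp only [Function.update_apply, ones, List.length_nil, List.replicate_zero, List.nil_append]
    split_ifs <;> simp_all
  | c :: w, R, hR => by
    have hbody : Runs (push b true) (Function.update R a w) (Function.update (Function.update R a w) b (true :: R b)) 1 := by
      refine (Runs.push b true _).of_eq ?_ le_rfl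
      simp [Function.update_of_ne hab.symm]
    have ih := runs_toUnary hab w (Function.update (Function.update R a w) b (true :: R b)) (by simp [Function.update_of_ne hab])
    have hfin : Function.update (Function.update (Function.update (Function.update R a w) b (true :: R b)) a []) b
        (ones w.length ++ Function.update (Function.update R a w) b (true :: R b) b) =
        Function.update (Function.update R a []) b (ones (c :: w).length ++ R b) := by
      ext i : 1
      simp only [Function.update_apply, ones, List.length_cons, List.replicate_succ']
      split_ifs <;> simp_all
    cases c
    · exact (Runs.loop_false hR hbody (ih.of_eq hfin le_rfl)).of_eq rfl (by simp; omega)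
    · exact (Runs.loop_true hR hbody (ih.of_eq hfin le_rfl)).of_eq rfl (by simp; omega)

end Generic

/-- The body of the unary maximum: drop one unit of `cn` (if any) and push one unit on `scr`. [folklore] -/
def maxUBody : Com (K ⊕ AReg) :=
  pop (Sum.inl K.cn) (push (Sum.inl K.scr) true) (push (Sum.inl K.scr) true) (push (Sum.inl K.scr) true)

/-- `maxU`: with `1^a` on `cn` and `1^b` on `cn2`, leave `1^{a ∸ b}` on `cn` and push `1^b` on `scr`
(so that `cn` poured on `scr` gives `1^{max a b}`). [folklore] -/
def maxU : Com (K ⊕ AReg) := loop (Sum.inl K.cn2) maxUBody maxUBody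

/-- Effect of `maxU`, cost `5 b + 1`. [folklore] -/
theorem runs_maxU (F : Regs AReg) : ∀ (b a : ℕ) (ρ : St), ρ.cn = ones a → ρ.cn2 = ones b →
    Runs maxU (state ρ F) (state { ρ with cn := ones (a - b), cn2 := [], scr := ones b ++ ρ.scr } F) (5 * b + 1)
  | 0, a, ρ, hcn, hcn2 => by
    refine (Runs.loop_nil _ _ (by simp [state, hcn2, ones])).of_eq ?_ (by simp)
    simp only [state]; congr 1; cases ρ; simp only at hcn hcn2; simp [hcn, hcn2, ones]
  | b + 1, a, ρ, hcn, hcn2 => by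
    have hk : state ρ F (Sum.inl K.cn2) = true :: ones b := by simp [state, hcn2, ones, List.replicate_succ]
    set ρ₀ : St := { ρ with cn2 := ones b } with hρ₀
    have hupd : Function.update (state ρ F) (Sum.inl K.cn2) (ones b) = state ρ₀ F := by simp [state, hρ₀]
    -- the body
    have hbody : Runs maxUBody (state ρ₀ F) (state { ρ₀ with cn := ones (a - 1), scr := true :: ρ.scr } F) 3 := by
      rcases Nat.eq_zero_or_pos a with rfl | ha
      · refine (Runs.pop_nil _ _ (by simp [state, hρ₀, hcn, ones]) (Runs.push _ _ _)).of_eq ?_ (by norm_num)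
        simp only [state, Sum.update_elim_inl, update_regs_scr, Sum.elim_inl, regs_scr, hρ₀]
        congr 1; cases ρ; simp only at hcn; simp [hcn, ones]
      · obtain ⟨a', rfl⟩ : ∃ a', a = a' + 1 := ⟨a - 1, by omega⟩
        refine (Runs.pop_true' _ _ (w := ones a') (by simp [state, hρ₀, hcn, ones, List.replicate_succ]) rfl
          (Runs.push _ _ _)).of_eq ?_ (by norm_num)
        simp only [state, Sum.update_elim_inl, update_regs_cn, update_regs_scr, Sum.elim_inl, regs_scr, hρ₀,
          Nat.add_sub_cancel]
    have ih := runs_maxU F b (a - 1) { ρ₀ with cn := ones (a - 1), scr := true :: ρ.scr } rfl rfl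
    refine (Runs.loop_true' hk hupd hbody ih).of_eq ?_ (by omega)
    simp only [state, hρ₀, show a - 1 - b = a - (b + 1) by omega]
    congr 1
    simp [ones, List.replicate_succ']

/-- `predX`: `x := x - 1` on a canonical numeral of a positive number (subtract `[1]`, normalise).
[folklore] -/
def predX : Com (K ⊕ AReg) :=
  (((push (Sum.inr AReg.y) true ;; bk sub) ;; clear (Sum.inr AReg.g)) ;; clear (Sum.inr AReg.y)) ;; bk normalize

/-- Effect of `predX` (`v ≥ 1`), cost `≤ 25 |encodeNat v| + 40`. [folklore] -/
theorem runs_predX (ρ : St) {v : ℕ} (hv : 1 ≤ v) :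
    Runs predX (state ρ (AReg.file (encodeNat v) [] [] [] [] [] [] [])) (state ρ (AReg.file (encodeNat (v - 1)) [] [] [] [] [] [] []))
      (25 * (encodeNat v).length + 40) := by
  have hbor : subBorrow (encodeNat v) [true] = false := by
    rw [subBorrow_iff, bitsToNat_encodeNat]; simp; omega
  have hval : norm (subRes (encodeNat v) [true]) = encodeNat (v - 1) := by
    rw [norm_eq_encodeNat, bitsToNat_subRes _ _ (by rw [bitsToNat_encodeNat]; simp; omega), bitsToNat_encodeNat]
    rfl
  have hlen : (subRes (encodeNat v) [true]).length = (encodeNat v).length := length_subRes _ _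
  have c1 := Runs.push (Sum.inr AReg.y) true (state ρ (AReg.file (encodeNat v) [] [] [] [] [] [] []))
  simp only [state, Sum.elim_inr, AReg.file_y, Sum.update_elim_inr, AReg.update_file_y] at c1
  have c2 := c1.seq ((runs_sub (encodeNat v) [true] []).inr _)
  rw [hbor] at c2
  simp only [Bool.not_false, cond_false, flag_true] at c2
  have c3 := (c2.seq (runs_clear (Sum.inr AReg.g : K ⊕ AReg) _)).seq (runs_clear (Sum.inr AReg.y : K ⊕ AReg) _)
  simp only [Sum.elim_inr, AReg.file_g, Sum.update_elim_inr, AReg.update_file_g, AReg.file_y, AReg.update_file_y,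
    List.length_singleton] at c3
  have c4 := c3.seq ((runs_normalize (subRes (encodeNat v) [true]) [] [] [] [] []).inr _)
  rw [hval] at c4
  exact c4.of_eq rfl (by omega)

/-- `widthRuler kw`: the ruler `1^{kw · max ℓ₁ ℓ₂}` for `ℓ₁ = |encodeNat (A - 1)|` (the numeral length
of the input length) and `ℓ₂ = |encodeNat (n' - 1)| + 1` (that of the largest literal code
`2(n'-1)+1`); `nb`, `nrev`, `tokc` are consumed or cleared. [folklore] -/
def widthRuler (kw : ℕ) : Com (K ⊕ AReg) :=
  ((((((((((((copy (Sum.inl K.adr) (Sum.inr AReg.x) (Sum.inl K.tmp) (Sum.inr AReg.s) ;; predX) ;;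
    toUnary (Sum.inr AReg.x) (Sum.inl K.cn)) ;;
    move (Sum.inl K.nb) (Sum.inr AReg.x) (Sum.inl K.tmp)) ;; predX) ;; push (Sum.inr AReg.x) true) ;;
    toUnary (Sum.inr AReg.x) (Sum.inl K.cn2)) ;;
    maxU) ;; pour (Sum.inl K.cn) (Sum.inl K.scr)) ;; pour (Sum.inl K.scr) (Sum.inl K.cn)) ;; repCopy kw) ;;
    clear (Sum.inl K.cn)) ;; clear (Sum.inl K.nrev)) ;; clear (Sum.inl K.tokc)

/-- The word size computed by `widthRuler`. [folklore] -/
def wsize (kw A n' : ℕ) : ℕ := kw * max (encodeNat (A - 1)).length ((encodeNat (n' - 1)).length + 1)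

/-- **Effect of `widthRuler`** (`A, n' ≥ 1`). [folklore] -/
theorem runs_widthRuler (kw A T n' : ℕ) (hA : 1 ≤ A) (hn : 1 ≤ n') (e : Bool) (E : List (List Bool × List Bool)) :
    Runs (widthRuler kw)
      (state { St.zero with
        nrev := (encodeNat n').reverse, nb := encodeNat n', tokc := ones T, adr := encodeNat A, he := flag e
        mem := encLog E } F0)
      (state { St.zero with adr := encodeNat A, he := flag e, mem := encLog E, wr := ones (wsize kw A n') } F0)
      (70 * (encodeNat A).length + 70 * (encodeNat n').length + (kw + 1) * (10 * ((encodeNat A).length +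
        (encodeNat n').length + 1) + 3) + 2 * T + 120) := by
  set a := (encodeNat A).length with ha
  set b := (encodeNat n').length with hb
  have l1 : (encodeNat (A - 1)).length ≤ a := Brick.length_encodeNat_mono (Nat.sub_le A 1)
  have l2 : (encodeNat (n' - 1)).length ≤ b := Brick.length_encodeNat_mono (Nat.sub_le n' 1)
  set ℓ₁ := (encodeNat (A - 1)).length with hℓ₁
  set ℓ₂ := (encodeNat (n' - 1)).length + 1 with hℓ₂
  have c1 := runs_copy (a := (Sum.inl K.adr : K ⊕ AReg)) (b := Sum.inr AReg.x) (t := Sum.inl K.tmp) (u := Sum.inr AReg.s)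
    (by simp) (by simp) (by simp) (by simp) (by simp) (by simp)
    (state { St.zero with
        nrev := (encodeNat n').reverse, nb := encodeNat n', tokc := ones T, adr := encodeNat A, he := flag e
        mem := encLog E } F0) (by simp [state, St.zero]) (by simp [state])
  simp only [state, Sum.elim_inl, regs_adr, Sum.elim_inr, F0, AReg.file_x, List.append_nil, Sum.update_elim_inr,
    AReg.update_file_x] at c1
  have c2 := c1.seq (runs_predX _ hA)
  have c3 := c2.seq (runs_toUnary (a := (Sum.inr AReg.x : K ⊕ AReg)) (b := Sum.inl K.cn) (by simp) _ _ rfl)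
  simp only [Sum.elim_inr, AReg.file_x, Sum.elim_inl, regs_cn, zero_cn, List.append_nil, Sum.update_elim_inr,
    AReg.update_file_x, Sum.update_elim_inl, update_regs_cn] at c3
  have c4 := c3.seq (runs_move (a := (Sum.inl K.nb : K ⊕ AReg)) (b := Sum.inr AReg.x) (t := Sum.inl K.tmp) (by simp)
    (by simp) (by simp) _ (by simp [St.zero]))
  simp only [Sum.elim_inl, regs_nb, Sum.elim_inr, AReg.file_x, List.append_nil, Sum.update_elim_inl, update_regs_nb,
    Sum.update_elim_inr, AReg.update_file_x] at c4
  have c5 := c4.seq (runs_predX _ hn)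
  have c6 := c5.seq (Runs.push (Sum.inr AReg.x) true _)
  simp only [Sum.elim_inr, AReg.file_x, Sum.update_elim_inr, AReg.update_file_x] at c6
  have c7 := c6.seq (runs_toUnary (a := (Sum.inr AReg.x : K ⊕ AReg)) (b := Sum.inl K.cn2) (by simp) _ _ rfl)
  simp only [Sum.elim_inr, AReg.file_x, Sum.elim_inl, regs_cn2, zero_cn2, List.append_nil, Sum.update_elim_inr,
    AReg.update_file_x, Sum.update_elim_inl, update_regs_cn2, List.length_cons] at c7
  rw [← hℓ₁, ← hℓ₂] at c7
  have c8 := c7.seq (runs_maxU _ ℓ₂ ℓ₁ _ rfl rfl)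
  have c9 := c8.seq (runs_pour (a := (Sum.inl K.cn : K ⊕ AReg)) (b := Sum.inl K.scr) (by simp) _)
  simp only [state, Sum.elim_inl, regs_cn, regs_scr, zero_scr, Sum.update_elim_inl, update_regs_cn, update_regs_scr,
    List.length_replicate, ones, List.reverse_replicate, List.append_nil, List.replicate_append_replicate] at c9
  have hmax : ℓ₁ - ℓ₂ + ℓ₂ = max ℓ₁ ℓ₂ := by omega
  rw [hmax] at c9
  have c10 := c9.seq (runs_pour (a := (Sum.inl K.scr : K ⊕ AReg)) (b := Sum.inl K.cn) (by simp) _)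
  simp only [Sum.elim_inl, regs_scr, regs_cn, Sum.update_elim_inl, update_regs_scr, update_regs_cn,
    List.length_replicate, List.reverse_replicate, List.append_nil] at c10
  have c11 := c10.seq (runs_repCopy (max ℓ₁ ℓ₂) kw _ (by simp [ones]) (by simp [St.zero]))
  have c12 := ((c11.seq (runs_clear (Sum.inl K.cn : K ⊕ AReg) _)).seq (runs_clear (Sum.inl K.nrev : K ⊕ AReg) _)).seq
    (runs_clear (Sum.inl K.tokc : K ⊕ AReg) _)
  simp only [state, Sum.elim_inl, regs_cn, Sum.update_elim_inl, update_regs_cn, regs_nrev, update_regs_nrev, regs_tokc,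
    update_regs_tokc, List.length_replicate, List.length_reverse] at c12
  refine c12.of_eq ?_ ?_
  · simp [state, St.zero, F0, wsize, ones, hℓ₁, hℓ₂]
  · have hm : max ℓ₁ ℓ₂ ≤ a + b + 1 := by omega
    have hk : kw * (10 * max ℓ₁ ℓ₂ + 3) ≤ (kw + 1) * (10 * (a + b + 1) + 3) :=
      Nat.mul_le_mul (Nat.le_succ _) (by omega)
    omega

/-! ### The post-pass and the whole front end -/

/-- `postPassQ kw N`: the header on `n + N` variables, the exact ruler, the run flag; the address
counter is dropped. [folklore] -/
def postPassQ (kw N : ℕ) : Com (K ⊕ AReg) :=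
  (((((bumpN N ;; hdrE01) ;; hdrE23) ;; hdrE45) ;; widthRuler kw) ;; push (Sum.inl K.run) true) ;; clear (Sum.inl K.adr)

/-- The cost of `postPassQ`. [folklore] -/
def postCostQ (kw N A m T n : ℕ) : ℕ :=
  (9 * N + 21) * (encodeNat (n + N)).length + 14 * N + 142 * (encodeNat A).length + 184 * (encodeNat (n + N)).length +
    22 * (encodeNat (m + 1)).length + 9 * (encodeNat m).length +
    (kw + 1) * (10 * ((encodeNat A).length + (encodeNat (n + N)).length + 1) + 3) + 2 * T + 440

/-- **Effect of `postPassQ`** from the end of a well-formed token pass (`A ≥ 1`, `N ≥ 1`): the log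
gains the header entries of the clause list on `n + N` variables, the ruler holds `1^{wsize kw A (n+N)}`,
the run flag is armed, and only `he` survives of the front-end registers. [folklore] -/
theorem runs_postPassQ (kw N A m T n : ℕ) (hA : 1 ≤ A) (hN : 1 ≤ N) (e : Bool) (E : List (List Bool × List Bool)) :
    Runs (postPassQ kw N)
      (state { St.zero with
        nrev := (encodeNat n).reverse, nrev2 := (encodeNat n).reverse, tokc := ones T
        adr := encodeNat A, mc := encodeNat m, he := flag e, mem := encLog E } F0)
      (state { St.zero with
        he := flag e, mem := encLog (hdrLog (n + N) m A ++ E), wr := ones (wsize kw A (n + N)), run := [true] } F0)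
      (postCostQ kw N A m T n) := by
  have c0 := runs_bumpN A m T n N e E
  have c1 := c0.seq (runs_hdrE01 A m T (n + N) hA e E)
  have c2 := c1.seq (runs_hdrE23 A m T (n + N) e _)
  have c3 := c2.seq (runs_hdrE45 A T (n + N) e _)
  have c4 := c3.seq (runs_widthRuler kw A T (n + N) hA (by omega) e _)
  have c5 := c4.seq (Runs.push (Sum.inl K.run) true _)
  have c6 := c5.seq (runs_clear (Sum.inl K.adr : K ⊕ AReg) _)
  simp only [state, Sum.elim_inl, regs_run, zero_run, Sum.update_elim_inl, update_regs_run, regs_adr, update_regs_adr]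
    at c6
  refine c6.of_eq ?_ ?_
  · simp only [state, hdrLog, List.cons_append, List.nil_append]
    congr 1
  · unfold postCostQ
    omega

/-- `frontEndQ kw N`: the address counter and header mode, the token loop, then `postPassQ`. [folklore] -/
def frontEndQ (kw N : ℕ) : Com (K ⊕ AReg) :=
  ((pushNum (Sum.inl K.adr) (encodeNat 6) ;; push (Sum.inl K.ph) true) ;; mainLoop) ;; postPassQ kw N

/-- A uniform bound of `postCostQ` in terms of `kw`, `N`, `n` and the token count `T` (`A ≤ T + 6`,
`m ≤ T`): every numeral involved has length at most `n + N + T + 8`. [folklore] -/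
def postCostQB (kw N n T : ℕ) : ℕ :=
  (9 * N + 400) * (n + N + T + 8) + 14 * N + (kw + 1) * (20 * (n + N + T + 8) + 13) + 2 * T + 440

set_option maxRecDepth 4000 in
/-- `postCostQ ≤ postCostQB`. [folklore] -/
theorem postCostQ_le (kw N A m T n : ℕ) (hA : A ≤ T + 6) (hm : m ≤ T) : postCostQ kw N A m T n ≤ postCostQB kw N n T := by
  have e1 := TM2Pass.length_encodeNat_le_self A
  have e2 := TM2Pass.length_encodeNat_le_self (n + N)
  have e3 := TM2Pass.length_encodeNat_le_self (m + 1)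
  have e4 := TM2Pass.length_encodeNat_le_self m
  have b2 : (encodeNat (n + N)).length ≤ n + N + T + 8 := by omega
  have m1 : (9 * N + 21) * (encodeNat (n + N)).length ≤ (9 * N + 21) * (n + N + T + 8) := Nat.mul_le_mul_left _ b2
  have m2 : (kw + 1) * (10 * ((encodeNat A).length + (encodeNat (n + N)).length + 1) + 3) ≤
      (kw + 1) * (20 * (n + N + T + 8) + 13) := Nat.mul_le_mul_left _ (by omega)
  have m3 : (9 * N + 21) * (n + N + T + 8) + 357 * (n + N + T + 8) ≤ (9 * N + 400) * (n + N + T + 8) := by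
    rw [← Nat.add_mul]; exact Nat.mul_le_mul_right _ (by omega)
  unfold postCostQ postCostQB
  omega

/-- The cost of the front end on `T` tokens. [folklore] -/
def frontCostQ (kw N n T : ℕ) : ℕ := T * tokCostB (T + 6) + postCostQB kw N n T + 5

/-- **The front end** on the token code of a header `n` and a coded clause list `F` (`N ≥ 1`): it ends
with the empty-clause flag on `he`, the ruler `1^{wsize kw A (n+N)}` (`A = 6 + |dataWords F|`), the run
flag armed, and on `mem` a log which is, up to the order of its entries, the segment log at `0` of the
memory image `wordsOf (n + N) F`; within `frontCostQ kw N n T` steps. [folklore] -/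
theorem runs_frontEndQ (kw N n : ℕ) (hN : 1 ≤ N) (F : CNF (List Bool)) :
    ∃ E : List (List Bool × List Bool), E.Perm (segLog 0 (wordsOf (n + N) F)) ∧ E.length = 6 + (dataWords F).length ∧
      Runs (frontEndQ kw N) (state { St.zero with inp := bits (hdrToks n ++ formulaToks F) } F0)
        (state { St.zero with
          he := flag (decide ([] ∈ F)), mem := encLog E
          wr := ones (wsize kw (6 + (dataWords F).length) (n + N)), run := [true] } F0)
        (frontCostQ kw N n (hdrToks n ++ formulaToks F).length) := by
  set ts := hdrToks n ++ formulaToks F with hts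
  -- the prelude
  have c1 := runs_pushNum (Sum.inl K.adr : K ⊕ AReg) (encodeNat 6) (state { St.zero with inp := bits ts } F0)
  have c2 := c1.seq (Runs.push (Sum.inl K.ph) true _)
  simp only [state, Sum.elim_inl, regs_adr, zero_adr, List.append_nil, Sum.update_elim_inl, update_regs_adr, regs_ph,
    zero_ph, update_regs_ph] at c2
  have c2' : Runs (pushNum (Sum.inl K.adr) (encodeNat 6) ;; push (Sum.inl K.ph) true)
      (state { St.zero with inp := bits ts } F0) (state (fsSt fs0 (bits ts)) F0) 4 := by
    refine c2.of_eq ?_ (by decide)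
    simp [state, fsSt, fs0, St.zero, flag, ones, TokConv.encodeNat_zero']
  -- the token loop
  have hinv : fs0.inv := fun _ => rfl
  have hb : Bnd (ts.length + 6) ts.length fs0 := ⟨by simp [fs0]; omega, by simp [fs0], by simp [fs0], by simp [fs0], by simp [fs0]⟩
  have c3 := c2'.seq (mainLoop_toks ts fs0 hinv hb)
  -- the fold, functionally
  set s2 : FS := ⟨6, 0, 0, 0, (encodeNat n).length + 1, false, false, [], [], false, (encodeNat n).reverse⟩ with hs2
  have hf : ts.foldl tokStep fs0 = formulaPass s2 F := by
    rw [hts, List.foldl_append, foldl_tokStep_hdrToks n fs0 rfl, ← foldl_tokStep_formulaToks F s2 rfl rfl]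
    congr 1
    simp [fs0, hs2]
  have hT : (formulaPass s2 F).T = ts.length := by
    rw [← hf, T_foldl_tokStep]; simp [fs0]
  obtain ⟨i1, i2, i3, i4, i5, i6, i7, i8, i9, i10⟩ := formulaPass_spec F s2 rfl rfl rfl rfl
  rcases hsp : formulaPass s2 F with ⟨A, A0, c, m, T, ic, e, lit, E, hm, nr⟩
  rw [hsp] at i1 i2 i3 i4 i5 i6 i7 i8 i9 i10 hT
  simp only [hs2] at i1 i2 i3 i4 i5 i6 i7 i8 i9 i10 hT
  simp only [Bool.false_or, List.append_nil] at i9 i10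
  simp only [Nat.zero_add] at i8
  subst i1 i2 i3 i4 i5 i6 i7 i8 i9 hT
  rw [hf, hsp, fsSt_final] at c3
  -- the post-pass
  have hA : 1 ≤ 6 + (dataWords F).length := by omega
  have c4 := c3.seq (runs_postPassQ kw N (6 + (dataWords F).length) (F.filter fun c => c ≠ []).length ts.length n hA hN
    (decide ([] ∈ F)) E)
  refine ⟨hdrLog (n + N) (F.filter fun c => c ≠ []).length (6 + (dataWords F).length) ++ E, ?_, ?_, c4.of_eq rfl ?_⟩
  · rw [hdrLog_eq, wordsOf, segLog_append, show (hdrWords (n + N) (F.filter fun c => c ≠ []).length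
      (6 + (dataWords F).length)).length = 6 from rfl]
    exact (List.Perm.append (List.reverse_perm _) i10)
  · rw [List.length_append, hdrLog_eq, List.length_reverse, length_segLog, i10.length_eq, length_segLog]; rfl
  · have h1 := postCostQ_le kw N (6 + (dataWords F).length) (F.filter fun c => c ≠ []).length ts.length n
      (by have := length_dataWords_le F; rw [hts, List.length_append]; omega)
      (by have := length_filter_le_formulaToks F; rw [hts, List.length_append]; omega)
    simp only [frontCostQ, Nat.add_comm ts.length 6]
    omega

/-! ### The whole program -/

/-- The branch after the front end: an empty clause (flag `he`) gives the answer `false`; otherwise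
interpret the RAM program with 3SUM queries and read the answer bit. [folklore] -/
def branchQ (M : Program) : Com (K ⊕ AReg) :=
  ifFlag (Sum.inl K.he) (push (Sum.inl K.out) false) (interpQ M ;; readOutBit)

/-- The whole program of the simulating machine: front end, branch, cleanup. [folklore] -/
def decideProgQ (kw N : ℕ) (M : Program) : Com (K ⊕ AReg) :=
  (frontEndQ kw N ;; branchQ M) ;; cleanup

/-- The token code of `φ` (header and coded clause list). [folklore] -/
def toksQ (φ : KCNF k) : List LightSearch.Tok := hdrToks φ.numVars ++ formulaToks (formulaOf φ)

/-- The initial register file of the program on `φ`. [folklore] -/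
def inStQ (φ : KCNF k) : St := { St.zero with inp := bits (toksQ φ) }

/-- The word size handed to the RAM on `φ`: `wsize kw A (n + N)` for the front end's final address `A`.
[folklore] -/
def wszQ (kw N : ℕ) (φ : KCNF k) : ℕ := wsize kw (6 + (dataWords (formulaOf φ)).length) (φ.numVars + N)

/-- The uniform bound of the words of the memory image on the header `n + N`: `2(n+N) + T + 5`.
[folklore] -/
def bndQ (N : ℕ) (φ : KCNF k) : ℕ := 2 * (φ.numVars + N) + (toksQ φ).length + 5

/-- The coded clause list has at most `T` tokens. [folklore] -/
theorem length_formulaToks_le_toksQ (φ : KCNF k) : (formulaToks (formulaOf φ)).length ≤ (toksQ φ).length := by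
  simp [toksQ]

/-- Every word of the memory image on the header `n + N` is at most `bndQ N φ`. [folklore] -/
theorem wordsOf_le_bndQ (N : ℕ) (φ : KCNF k) {v : ℕ} (hv : v ∈ wordsOf (φ.numVars + N) (formulaOf φ)) : v ≤ bndQ N φ := by
  have hD := length_dataWords_le (formulaOf φ)
  have hm := length_filter_le_formulaToks (formulaOf φ)
  have hT := length_formulaToks_le_toksQ φ
  unfold bndQ
  rw [wordsOf, List.mem_append] at hv
  rcases hv with hv | hv
  · simp only [hdrWords, List.mem_cons, List.not_mem_nil, or_false] at hv
    rcases hv with rfl | rfl | rfl | rfl | rfl | rfl <;> omega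
  · rw [dataWords, List.mem_flatMap] at hv
    obtain ⟨c', hc', hv⟩ := hv
    simp only [formulaOf, List.mem_map] at hc'
    obtain ⟨c, hc, rfl⟩ := hc'
    by_cases hce : c = []
    · subst hce; simp [KCNFToRAM.clauseWords] at hv
    · rw [clauseWords_map_code c hce] at hv
      simp only [clauseData, List.mem_cons, List.mem_map] at hv
      rcases hv with rfl | ⟨l, hl, rfl⟩
      · have := length_clause_le_formulaToks φ hc; omega
      · have := φ.fst_lt_numVars c hc l hl
        have hb : l.2.toNat ≤ 1 := Bool.toNat_le l.2
        omega

/-- The memory image has at most `T + 6` words. [folklore] -/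
theorem length_wordsOf_le_toksQ (N : ℕ) (φ : KCNF k) : (wordsOf (φ.numVars + N) (formulaOf φ)).length ≤ (toksQ φ).length + 6 := by
  have := length_wordsOf_le (φ.numVars + N) (formulaOf φ)
  have := length_formulaToks_le_toksQ φ
  omega

/-- The code length of the front end's log is at most `(4 |encodeNat (bndQ + 1)| + 4)(T + 6)`. [folklore] -/
theorem length_encLog_frontEnd_le (N : ℕ) (φ : KCNF k) {E : List (List Bool × List Bool)}
    (hperm : E.Perm (segLog 0 (wordsOf (φ.numVars + N) (formulaOf φ)))) :
    (encLog E).length ≤ (4 * (encodeNat (bndQ N φ + 1)).length + 4) * ((toksQ φ).length + 6) := by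
  have hB : BoundedLog (encodeNat (bndQ N φ + 1)).length E :=
    boundedLog_of_perm_segLog hperm ((length_wordsOf_le_toksQ N φ).trans (by unfold bndQ; omega))
      fun v hv => (wordsOf_le_bndQ N φ hv).trans (Nat.le_succ _)
  refine (length_encLog_le hB).trans (Nat.mul_le_mul_left _ ?_)
  rw [hperm.length_eq, length_segLog]
  exact length_wordsOf_le_toksQ N φ

/-- **The program on a `k`-CNF with an empty clause**: answer `false`. [folklore] -/
theorem runs_decideProgQ_nil_mem (kw : ℕ) {N : ℕ} (hN : 1 ≤ N) (M : Program) (φ : KCNF k) (h0 : [] ∈ φ.clauses) :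
    Runs (decideProgQ kw N M) (state (inStQ φ) F0) (state (outSt false) F0)
      (frontCostQ kw N φ.numVars (toksQ φ).length +
        2 * ((4 * (encodeNat (bndQ N φ + 1)).length + 4) * ((toksQ φ).length + 6) + wszQ kw N φ) + 16) := by
  obtain ⟨E, hperm, hElen, hfe⟩ := runs_frontEndQ kw N φ.numVars hN (formulaOf φ)
  have hdec : decide ([] ∈ formulaOf φ) = true := decide_eq_true ((nil_mem_formulaOf_iff φ).2 h0)
  rw [hdec] at hfe
  have hL := length_encLog_frontEnd_le N φ hperm
  have hbr : Runs (branchQ M)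
      (state { St.zero with he := flag true, mem := encLog E, wr := ones (wszQ kw N φ), run := [true] } F0)
      (state { St.zero with he := flag true, mem := encLog E, wr := ones (wszQ kw N φ), run := [true], out := [false] } F0)
      4 := by
    refine runs_ifFlag_true _ rfl ((Runs.push _ false _).of_eq ?_ le_rfl)
    funext i; rcases i with i | i <;> cases i <;> rfl
  have htot := (hfe.seq hbr).seq (runs_cleanup (encLog E) (ones (wszQ kw N φ)) [true] [] [] [true] [false])
  refine htot.of_eq rfl ?_
  simp only [List.length_replicate, ones, List.length_singleton, List.length_nil, toksQ, wszQ]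
  simp only [toksQ] at hL
  omega

/-- **The program on a `k`-CNF without empty clause, given a halting run of the word RAM** with a 3SUM
oracle on `x = encodeCNFWords (paddedN N φ)` at the word size `W = wszQ kw N φ`, all words of `|x| :: x`
fitting in a word, ending with `0` or `1` in cell `1`: the answer is that bit. The cost beyond the front
end is linear in the number `ns` of simulated steps. [folklore] -/
theorem runs_decideProgQ_run {kw N : ℕ} (hN : 1 ≤ N) {M : Program} {O : List ℕ → List ℕ} (hO : ThreeSumAnswers O)
    (φ : KCNF k) (h0 : [] ∉ φ.clauses) {ns : ℕ} {cf : Cfg}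
    (hxb : ∀ v ∈ encodeCNFWords (paddedN N φ), v < 2 ^ wszQ kw N φ)
    (hl : (encodeCNFWords (paddedN N φ)).length < 2 ^ wszQ kw N φ)
    (hrun : run M (wszQ kw N φ) O zeroCoins ns (WordRAM.init (wszQ kw N φ) (encodeCNFWords (paddedN N φ))) = some cf)
    (hcf : cf.pc = none) (hb : cf.mem 1 = 0 ∨ cf.mem 1 = 1) :
    Runs (decideProgQ kw N M) (state (inStQ φ) F0) (state (outSt (decide (cf.mem 1 = 1))) F0)
      (frontCostQ kw N φ.numVars (toksQ φ).length +
        (ns * (stepCostQ (wszQ kw N φ) (encodeNat (2 * valueBound M (wszQ kw N φ) + 2)).length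
          (valueBound M (wszQ kw N φ)) (pcBound M) + 2 * pcBound M + 5) +
          22 * Lmax (encodeNat (2 * valueBound M (wszQ kw N φ) + 2)).length (valueBound M (wszQ kw N φ)) +
          2 * wszQ kw N φ + 26)) := by
  set W := wszQ kw N φ with hW
  set x := encodeCNFWords (paddedN N φ) with hx
  set V := valueBound M W with hV
  obtain ⟨E, hperm, hElen, hfe⟩ := runs_frontEndQ kw N φ.numVars hN (formulaOf φ)
  have hdec : decide ([] ∈ formulaOf φ) = false := decide_eq_false (mt (nil_mem_formulaOf_iff φ).1 h0)
  rw [hdec] at hfe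
  have himg := wordsOf_paddedN hN φ h0
  rw [← hx] at himg
  have hwV : 2 ^ W - 1 ≤ V := two_pow_sub_one_le_valueBound M W
  have h1V : 1 ≤ V := one_le_valueBound M W
  have hMV : M.maxConst ≤ V := maxConst_le_valueBound M W
  have h2W : 2 ^ W ≤ V + 1 := by have := Nat.one_le_two_pow (n := W); omega
  -- the log invariant of the initial memory
  have hrep : Represents E (WordRAM.init W x).mem := fun a => by
    rw [logLookup_of_perm_segLog hperm a, himg, init_mem_eq_getD _ _ hxb hl a]
  have hinv : LogInv (encodeNat (2 * V + 2)).length (V + 1) E (WordRAM.init W x).mem := by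
    refine ⟨hrep, ?_, (hperm.map Prod.fst).nodup_iff.2 (nodup_map_fst_segLog 0 _), fun e he => ?_⟩
    · refine boundedLog_of_perm_segLog hperm (V := 2 * V + 2) ?_ fun v hv => ?_
      · rw [himg, List.length_cons]; omega
      · rw [himg] at hv
        rcases List.mem_cons.1 hv with rfl | hv
        · omega
        · have := hxb v hv; omega
    · obtain ⟨a, v, ha, -, rfl⟩ := exists_of_mem_segLog _ 0 (hperm.subset he)
      refine ⟨a, ?_, rfl⟩
      rw [himg, List.length_cons] at ha; omega
  have hVmem : MemLE V (WordRAM.init W x).mem := init_memLE W x hwV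
  -- the interpreter
  obtain ⟨E_f, hinvf, hI⟩ := runs_interpQ hO hwV h1V hMV le_rfl ns (WordRAM.init W x) hinv hVmem
    (fun i hi => by simp only [WordRAM.init_pc, Option.some.injEq] at hi; omega) hrun hcf
  have c3 := (hI.seq (runs_readOutBit (W := W) hinvf.rep hb))
  have hbr : Runs (branchQ M) (state (cfgSt W E (some 0) (flag true)) F0)
      (state { cfgSt W E_f none [] with out := [decide (cf.mem 1 = 1)] } F0) _ :=
    runs_ifFlag_false _ rfl c3
  have hfe' : Runs (frontEndQ kw N) (state (inStQ φ) F0) (state (cfgSt W E (some 0) (flag true)) F0)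
      (frontCostQ kw N φ.numVars (toksQ φ).length) :=
    hfe.of_eq (by simp [state, cfgSt, St.zero, flag, hW, wszQ]) le_rfl
  have htot := (hfe'.seq hbr).seq (runs_cleanup (encLog E_f) (ones W) [] [] [] [] [decide (cf.mem 1 = 1)])
  refine htot.of_eq rfl ?_
  have hLf : (encLog E_f).length ≤ Lmax (encodeNat (2 * V + 2)).length V := hinvf.length_encLog_le
  simp only [List.length_replicate, ones, List.length_nil]
  omega

/-! ### The machine -/

/-- The compiled machine of `decideProgQ kw N M` (input register `inp`, output register `out`). [folklore] -/
noncomputable def machineQ (kw N : ℕ) (M : Program) : TM2ComputableAux Bool Bool :=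
  (compile ((decideProgQ kw N M).map (Fintype.equivFin (K ⊕ AReg)))).toAux
    (Fintype.equivFin (K ⊕ AReg) (Sum.inl K.inp)) (Fintype.equivFin (K ⊕ AReg) (Sum.inl K.out))

/-- A run of the program from `inStQ φ` to `outSt b` within `B` is a run of the compiled machine on the
token code with output `[b]` within `B + 1`. [folklore] -/
theorem machineQ_outputsWithin {kw N : ℕ} {M : Program} {φ : KCNF k} {b : Bool} {B : ℕ}
    (h : Runs (decideProgQ kw N M) (state (inStQ φ) F0) (state (outSt b) F0) B) :
    (machineQ kw N M).OutputsWithin (bits (toksQ φ)) [b] (B + 1) := by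
  have h' : Runs (decideProgQ kw N M) (Regs.init (Sum.inl K.inp) (bits (toksQ φ))) (Regs.init (Sum.inl K.out) [b]) B := by
    rw [init_inp, init_out]; exact h
  exact Com.outputsWithin_of_runs_equiv (Fintype.equivFin (K ⊕ AReg)) (Or.inl h')

/-! ### Cost bounds in one variable `Z` -/

set_option maxRecDepth 4000 in
/-- The front end costs `O(Z²)`. [folklore] -/
theorem frontCostQ_le_pow {Z kw N n T : ℕ} (hZ : 1 ≤ Z) (hT : T + 6 ≤ Z) (hn : n + N + 8 ≤ Z) (hk : kw + 1 ≤ Z) :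
    frontCostQ kw N n T ≤ 1600 * Z ^ 2 := by
  have he := TM2Pass.length_encodeNat_le_self (T + 6)
  have htok : tokCostB (T + 6) ≤ 211 * Z := by unfold tokCostB; omega
  have h1 : T * tokCostB (T + 6) ≤ 211 * Z ^ 2 :=
    calc _ ≤ Z * (211 * Z) := Nat.mul_le_mul (by omega) htok
      _ = 211 * Z ^ 2 := by ring
  have h2 : (9 * N + 400) * (n + N + T + 8) ≤ 818 * Z ^ 2 :=
    calc _ ≤ (409 * Z) * (2 * Z) := Nat.mul_le_mul (by omega) (by omega)
      _ = 818 * Z ^ 2 := by ring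
  have h3 : (kw + 1) * (20 * (n + N + T + 8) + 13) ≤ 53 * Z ^ 2 :=
    calc _ ≤ Z * (53 * Z) := Nat.mul_le_mul hk (by omega)
      _ = 53 * Z ^ 2 := by ring
  have hZ2 : Z ≤ Z ^ 2 := by nlinarith
  unfold frontCostQ postCostQB
  omega

/-- **The whole machine on the run path costs at most `9100 Z⁵ (ns + 1)`**: transducer (`5 L + 3`),
front end, `ns` simulated steps, answer, cleanup, and the final step. [folklore] -/
theorem total_run_le {Z T n N kw W β V P L ns : ℕ} (hZ : 1 ≤ Z) (hT : T + 6 ≤ Z) (hn : n + N + 8 ≤ Z) (hk : kw + 1 ≤ Z)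
    (hW : W ≤ Z) (hβ : β ≤ Z) (hV : V + 2 ≤ Z) (hP : P ≤ Z) (hL : L ≤ Z) :
    frontCostQ kw N n T + (ns * (stepCostQ W β V P + 2 * P + 5) + 22 * Lmax β V + 2 * W + 26) + 1 + (5 * L + 3) ≤
      9100 * Z ^ 5 * (ns + 1) := by
  have hF := frontCostQ_le_pow hZ hT hn hk
  have hS := stepCostQ_le_pow hZ hW hβ hV hP
  have hLm : Lmax β V ≤ 8 * Z ^ 2 := by
    unfold Lmax
    calc (4 * β + 4) * (V + 2) ≤ (8 * Z) * Z := Nat.mul_le_mul (by omega) hV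
      _ = 8 * Z ^ 2 := by ring
  have hZ2 : Z ≤ Z ^ 2 := by nlinarith
  have hZ5 : Z ^ 2 ≤ Z ^ 5 := Nat.pow_le_pow_right hZ (by norm_num)
  have hm : ns * (stepCostQ W β V P + 2 * P + 5) ≤ ns * (9100 * Z ^ 5) := Nat.mul_le_mul_left _ hS
  have e : 9100 * Z ^ 5 * (ns + 1) = ns * (9100 * Z ^ 5) + 9100 * Z ^ 5 := by ring
  rw [e]
  omega

/-- The whole machine on the empty-clause path costs at most `9100 Z⁵`. [folklore] -/
theorem total_nil_le {Z T n N kw W B L : ℕ} (hZ : 1 ≤ Z) (hT : T + 6 ≤ Z) (hn : n + N + 8 ≤ Z) (hk : kw + 1 ≤ Z)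
    (hW : W ≤ Z) (hB : B ≤ Z) (hL : L ≤ Z) :
    frontCostQ kw N n T + 2 * ((4 * B + 4) * (T + 6) + W) + 16 + 1 + (5 * L + 3) ≤ 9100 * Z ^ 5 := by
  have hF := frontCostQ_le_pow hZ hT hn hk
  have h1 : (4 * B + 4) * (T + 6) ≤ 8 * Z ^ 2 :=
    calc _ ≤ (8 * Z) * Z := Nat.mul_le_mul (by omega) hT
      _ = 8 * Z ^ 2 := by ring
  have hZ2 : Z ≤ Z ^ 2 := by nlinarith
  have hZ5 : Z ^ 2 ≤ Z ^ 5 := Nat.pow_le_pow_right hZ (by norm_num)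
  omega

/-! ### The word size `0` is contradictory -/

/-- At word size `0` the initial memory does not depend on the input. [folklore] -/
theorem init_zero_eq (x y : List ℕ) : WordRAM.init 0 x = WordRAM.init 0 y := by
  have hm : ∀ z : List ℕ, (WordRAM.init 0 z).mem = fun _ => 0 := fun z => by
    funext a
    rcases a with _ | i
    · rw [WordRAM.init_mem_zero]; simp [Nat.mod_one]
    · by_cases hi : i < z.length
      · rw [WordRAM.init_mem_succ 0 z i hi]; simp [Nat.mod_one]
      · exact WordRAM.init_mem_of_length_lt 0 z (i + 1) (by omega)
  have h : ∀ z : List ℕ, WordRAM.init 0 z = ⟨some 0, fun _ => 0, 0, []⟩ := fun z => by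
    rw [← hm z]; rfl
  rw [h x, h y]

/-- The halting configuration reached by `run` is unique. [folklore] -/
theorem run_halt_unique {M : Program} {w : ℕ} {O : List ℕ → List ℕ} {ρc : ℕ → ℕ} {c : Cfg} {n₁ n₂ : ℕ} {c₁ c₂ : Cfg}
    (h₁ : run M w O ρc n₁ c = some c₁) (hs₁ : step M w O ρc c₁ = none)
    (h₂ : run M w O ρc n₂ c = some c₂) (hs₂ : step M w O ρc c₂ = none) : c₁ = c₂ := by
  wlog hle : n₁ ≤ n₂ generalizing n₁ n₂ c₁ c₂
  · exact (this h₂ hs₂ h₁ hs₁ (by omega)).symm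
  obtain ⟨d, rfl⟩ := Nat.exists_eq_add_of_le hle
  rw [run_add, h₁, Option.bind_some] at h₂
  cases d with
  | zero => simpa using h₂
  | succ d => rw [run_succ_of_step_eq_none _ _ _ _ hs₁] at h₂; exact absurd h₂ (by simp)

/-- **The hypothesis is contradictory at word size `0`** (`c ≥ 2`): the satisfiable `x₀` and the
unsatisfiable `x₀ ∧ ¬x₀` are instances of `CNFSATWithSize c`, the two runs start from the same
configuration, and a deterministic machine cannot answer `[1]` on one and `[0]` on the other. [folklore] -/
theorem not_cnfSAT_ram_zero {c : ℕ} (hc : 2 ≤ c) (M : Program) (O : List ℕ → List ℕ) (t : CNF ℕ → ℕ)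
    (hM : ∀ φ : CNF ℕ, φ.numClauses + φ.size ≤ (φ.numVars + 1) ^ c →
      ∃ cfg : Cfg, HaltsWithin M (0 * inputWidth (encodeCNFWords φ)) O zeroCoins (encodeCNFWords φ) (t φ) cfg ∧
        readOut cfg.mem ∈ CNFSAT.Good φ) : False := by
  have h4 : 4 ≤ 2 ^ c := by
    calc 4 = 2 ^ 2 := by norm_num
      _ ≤ 2 ^ c := Nat.pow_le_pow_right (by norm_num) hc
  set φ₁ : CNF ℕ := [[(0, true)]] with hφ₁
  set φ₂ : CNF ℕ := [[(0, true)], [(0, false)]] with hφ₂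
  have hn₁ : φ₁.numVars = 1 := by rw [hφ₁]; rfl
  have hn₂ : φ₂.numVars = 1 := by rw [hφ₂]; rfl
  have hs₁ : φ₁.Satisfiable := ⟨fun _ => true, by rw [hφ₁]; rfl⟩
  have hs₂ : ¬ φ₂.Satisfiable := by
    rintro ⟨σ, hσ⟩
    rw [hφ₂] at hσ
    cases h : σ 0 <;> simp [CNF.eval, Literal.eval, h] at hσ
  obtain ⟨cf₁, hh₁, hg₁⟩ := hM φ₁ (by rw [hn₁]; change 1 + 1 ≤ 2 ^ c; omega)
  obtain ⟨cf₂, hh₂, hg₂⟩ := hM φ₂ (by rw [hn₂]; change 2 + 2 ≤ 2 ^ c; omega)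
  rw [CNFSAT_good_iff, if_pos hs₁] at hg₁
  rw [CNFSAT_good_iff, if_neg hs₂] at hg₂
  rw [Nat.zero_mul] at hh₁ hh₂
  obtain ⟨n₁, -, hr₁, hst₁⟩ := hh₁.exists_run
  obtain ⟨n₂, -, hr₂, hst₂⟩ := hh₂.exists_run
  rw [init_zero_eq (encodeCNFWords φ₂) (encodeCNFWords φ₁)] at hr₂
  have := run_halt_unique hr₁ hst₁ hr₂ hst₂
  rw [this, hg₂] at hg₁
  simp at hg₁

/-! ### The word size of the run -/

/-- The memory image has `6 + |dataWords|` words. [folklore] -/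
theorem length_wordsOf (n : ℕ) (F : CNF (List Bool)) : (wordsOf n F).length = 6 + (dataWords F).length := by
  simp [wordsOf, hdrWords]; omega

/-- **The ruler is the exact word size**: `wszQ kw N φ = kw · inputWidth (encodeCNFWords (paddedN N φ))`
(no empty clause, `N ≥ 1`). [folklore] -/
theorem wszQ_eq (kw : ℕ) {N : ℕ} (hN : 1 ≤ N) (φ : KCNF k) (h0 : [] ∉ φ.clauses) :
    wszQ kw N φ = kw * inputWidth (encodeCNFWords (paddedN N φ)) := by
  have himg := wordsOf_paddedN hN φ h0
  have hlen := length_wordsOf (φ.numVars + N) (formulaOf φ)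
  rw [himg, List.length_cons] at hlen
  unfold wszQ wsize
  rw [inputWidth_eq hN, show 6 + (dataWords (formulaOf φ)).length - 1 = (encodeCNFWords (paddedN N φ)).length by omega,
    show 2 * (φ.numVars + N) - 1 = 2 * (φ.numVars + N - 1) + 1 by omega, length_encodeNat_two_mul_add_one]

/-- `2^{wsize kw A n'} ≤ (2 A + 4 n' + 2)^{kw}`. [folklore] -/
theorem two_pow_wsize_le (kw A n' : ℕ) : 2 ^ wsize kw A n' ≤ (2 * A + 4 * n' + 2) ^ kw := by
  unfold wsize
  rw [Nat.mul_comm kw, Nat.pow_mul]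
  refine Nat.pow_le_pow_left ?_ kw
  have h1 := two_pow_length_encodeNat_le (A - 1)
  have h2 := two_pow_length_encodeNat_le (n' - 1)
  rcases le_total (encodeNat (A - 1)).length ((encodeNat (n' - 1)).length + 1) with h | h
  · rw [max_eq_right h, Nat.pow_succ]; omega
  · rw [max_eq_left h]; omega

/-- `wsize kw A n' ≤ kw (2 A + 4 n' + 2)`. [folklore] -/
theorem wsize_le (kw A n' : ℕ) : wsize kw A n' ≤ kw * (2 * A + 4 * n' + 2) := by
  have h := two_pow_wsize_le 1 A n'
  rw [pow_one] at h
  have hl : wsize 1 A n' < 2 ^ wsize 1 A n' := Nat.lt_two_pow_self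
  unfold wsize at h hl ⊢
  rw [Nat.one_mul] at h hl
  exact Nat.mul_le_mul_left _ (by omega)

/-! ### The named fact -/

/-- **The change of machine model at SETH granularity (Cook–Reckhow 1973, §2): discharge of the named
fact `sparseKSATInExpTime_of_cnfSATInThreeSumOracleRAMTime`.** For `c ≥ 2` and `ρ ≥ 0`, a
deterministic word-RAM oracle program deciding `CNFSATWithSize c` with the canonical 3SUM oracle in
`⌊C 2^{ρ n} + C⌋₊` steps at word size `k · inputWidth` yields, for all `k'`, `c'` and `η > 0`, a
multi-stack Turing machine deciding the `k'`-CNFs with at most `c' n` clauses in time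
`2^{(ρ+η)n} · poly(L)`: the machine is the input transducer followed by the compiled program
`decideProgQ k ((k'+1)c'+3) M`; its running time is `O(Z⁵ · (⌊C 2^{ρ(n+N)} + C⌋₊ + 1))` with
`Z = O(((L + 1)(n + 1))^k)` (`total_run_le`, `total_nil_le`). [cite: CookReckhow1973, §2] -/
theorem sparseKSATInExpTime_of_cnfSATInThreeSumOracleRAMTime_holds :
    sparseKSATInExpTime_of_cnfSATInThreeSumOracleRAMTime := by
  intro c ρ hc hρ hram k' c' η hη
  obtain ⟨M, kw, C, -, hM⟩ := hram
  set N := (k' + 1) * c' + 3 with hNdef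
  have hN1 : 1 ≤ N := by omega
  rcases Nat.eq_zero_or_pos kw with rfl | hkw
  · exact (not_cnfSAT_ram_zero hc M threeSumOracle (fun φ => ⌊C * (2 : ℝ) ^ (ρ * (φ.numVars : ℝ)) + C⌋₊) hM).elim
  obtain ⟨Mr, hMr⟩ := exists_recode_machine (k := k')
  have hO : ThreeSumAnswers threeSumOracle := fun q => rfl
  -- the constants of the analysis
  set S := 2 * M.maxConst + pcBound M + kw + 2 * N + 30 with hS
  set κ := (4 * N + 14) ^ kw * S with hκ
  set Zf : ℕ → ℕ → ℕ := fun n L => κ * ((L + 1) * (n + 1)) ^ kw with hZf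
  set Nb : ℕ → ℕ := fun n => ⌊C * (2 : ℝ) ^ (ρ * (((n + N : ℕ) : ℝ))) + C⌋₊ with hNb
  refine ⟨fun n L => 9100 * Zf n L ^ 5 * (Nb n + 1), ?_, ⟨Mr.comp (machineQ kw N M), fun φ => ?_⟩⟩
  · -- the time bound is `O(2^{(ρ+η) n} poly(L))`
    obtain ⟨C₁, hC₁0, hC₁⟩ := exists_pow_le_two_rpow (5 * kw) hη
    set Cp : ℝ := max C 0 with hCp
    have hCp0 : 0 ≤ Cp := le_max_right _ _
    set C₂ : ℝ := Cp * (2 : ℝ) ^ (ρ * N) + Cp + 1 with hC₂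
    have hC₂0 : 0 ≤ C₂ := by positivity
    set K : ℝ := 9100 * (κ : ℝ) ^ 5 * C₁ * C₂ with hK
    have hK0 : 0 ≤ K := by positivity
    refine ⟨max ⌈K⌉₊ (5 * kw), fun n L => ?_⟩
    have hX1 : (1 : ℝ) ≤ (2 : ℝ) ^ (ρ * n) := Real.one_le_rpow (by norm_num) (by positivity)
    have hNb1 : ((Nb n : ℕ) : ℝ) + 1 ≤ C₂ * (2 : ℝ) ^ (ρ * n) := by
      have h0 : (0 : ℝ) ≤ (2 : ℝ) ^ (ρ * (((n + N : ℕ) : ℝ))) := by positivity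
      have hfl : ((Nb n : ℕ) : ℝ) ≤ Cp * (2 : ℝ) ^ (ρ * (((n + N : ℕ) : ℝ))) + Cp := by
        have h1 : C * (2 : ℝ) ^ (ρ * (((n + N : ℕ) : ℝ))) + C ≤ Cp * (2 : ℝ) ^ (ρ * (((n + N : ℕ) : ℝ))) + Cp :=
          add_le_add (mul_le_mul_of_nonneg_right (le_max_left _ _) h0) (le_max_left _ _)
        exact (Nat.cast_le.2 (Nat.floor_le_floor h1)).trans (Nat.floor_le (by positivity))
      have e : (2 : ℝ) ^ (ρ * (((n + N : ℕ) : ℝ))) = (2 : ℝ) ^ (ρ * N) * (2 : ℝ) ^ (ρ * n) := by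
        rw [← Real.rpow_add (by norm_num)]; congr 1; push_cast; ring
      rw [e] at hfl
      have : Cp + 1 ≤ (Cp + 1) * (2 : ℝ) ^ (ρ * n) := by nlinarith
      calc ((Nb n : ℕ) : ℝ) + 1 ≤ Cp * ((2 : ℝ) ^ (ρ * N) * (2 : ℝ) ^ (ρ * n)) + Cp + 1 := by linarith
        _ ≤ Cp * ((2 : ℝ) ^ (ρ * N) * (2 : ℝ) ^ (ρ * n)) + (Cp + 1) * (2 : ℝ) ^ (ρ * n) := by linarith
        _ = C₂ * (2 : ℝ) ^ (ρ * n) := by rw [hC₂]; ring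
    have hpow : ((((L + 1) * (n + 1) : ℕ) : ℝ) ^ kw) ^ 5 ≤ ((L : ℝ) + 1) ^ (5 * kw) * (C₁ * (2 : ℝ) ^ (η * n)) := by
      have e : ((((L + 1) * (n + 1) : ℕ) : ℝ) ^ kw) ^ 5 = ((L : ℝ) + 1) ^ (5 * kw) * (((n : ℝ) + 1) ^ (5 * kw)) := by
        push_cast; rw [← pow_mul, mul_pow, Nat.mul_comm kw 5]
      rw [e]
      exact mul_le_mul_of_nonneg_left (hC₁ n) (by positivity)
    have hL1 : (1 : ℝ) ≤ (L : ℝ) + 1 := by simp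
    have hc1 : K ≤ ((max ⌈K⌉₊ (5 * kw) : ℕ) : ℝ) := (Nat.le_ceil _).trans (by exact_mod_cast le_max_left _ _)
    have hc2 : ((L : ℝ) + 1) ^ (5 * kw) ≤ ((L : ℝ) + 1) ^ (max ⌈K⌉₊ (5 * kw)) := pow_le_pow_right₀ hL1 (le_max_right _ _)
    have e2 : (2 : ℝ) ^ (η * n) * (2 : ℝ) ^ (ρ * n) = (2 : ℝ) ^ ((ρ + η) * n) := by
      rw [← Real.rpow_add (by norm_num)]; ring_nf
    show (((9100 * Zf n L ^ 5 * (Nb n + 1) : ℕ)) : ℝ) ≤ _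
    have eZ : (((9100 * Zf n L ^ 5 * (Nb n + 1) : ℕ)) : ℝ) =
        9100 * (κ : ℝ) ^ 5 * (((((L + 1) * (n + 1) : ℕ) : ℝ) ^ kw) ^ 5) * (((Nb n : ℕ) : ℝ) + 1) := by
      rw [hZf]; push_cast; ring
    rw [eZ]
    calc 9100 * (κ : ℝ) ^ 5 * (((((L + 1) * (n + 1) : ℕ) : ℝ) ^ kw) ^ 5) * (((Nb n : ℕ) : ℝ) + 1)
        ≤ 9100 * (κ : ℝ) ^ 5 * (((L : ℝ) + 1) ^ (5 * kw) * (C₁ * (2 : ℝ) ^ (η * n))) * (C₂ * (2 : ℝ) ^ (ρ * n)) := by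
          gcongr
      _ = K * (2 : ℝ) ^ ((ρ + η) * n) * ((L : ℝ) + 1) ^ (5 * kw) := by rw [hK, ← e2]; ring
      _ ≤ ((max ⌈K⌉₊ (5 * kw) : ℕ) : ℝ) * (2 : ℝ) ^ ((ρ + η) * n) * ((L : ℝ) + 1) ^ (5 * kw) := by gcongr
      _ ≤ ((max ⌈K⌉₊ (5 * kw) : ℕ) : ℝ) * (2 : ℝ) ^ ((ρ + η) * n) * ((L : ℝ) + 1) ^ (max ⌈K⌉₊ (5 * kw)) := by gcongr
  · -- one instance
    obtain ⟨φ, hsp⟩ := φ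
    set n := φ.numVars with hn
    set L := φ.encode.length with hL
    set Z := Zf n L with hZ
    set G := (L + 1) * (n + 1) with hG
    have hrec := hMr φ
    -- the bookkeeping of `Z = P · S`, `P = (4N+14)^kw G^kw`
    have hT4 : (toksQ φ).length ≤ 4 * L := (length_le_length_bits _).trans (length_bits_hdr_formulaOf_le φ)
    have hG1 : 1 ≤ G := by rw [hG]; exact Nat.one_le_iff_ne_zero.2 (Nat.mul_ne_zero (by omega) (by omega))
    have hGn : L + n + 1 ≤ G := by
      have e : (L + 1) * (n + 1) = L * n + L + n + 1 := by ring
      rw [hG, e]; omega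
    have hGk : G ≤ G ^ kw := by
      calc G = G ^ 1 := (pow_one G).symm
        _ ≤ G ^ kw := Nat.pow_le_pow_right hG1 hkw
    have h4N : 4 * N + 14 ≤ (4 * N + 14) ^ kw := by
      calc 4 * N + 14 = (4 * N + 14) ^ 1 := (pow_one _).symm
        _ ≤ (4 * N + 14) ^ kw := Nat.pow_le_pow_right (by omega) hkw
    set P := (4 * N + 14) ^ kw * G ^ kw with hP
    have hκ1 : 1 ≤ (4 * N + 14) ^ kw := Nat.one_le_pow _ _ (by omega)
    have hP1 : 1 ≤ P := by rw [hP]; exact Nat.one_le_iff_ne_zero.2 (Nat.mul_ne_zero (by omega) (Nat.pow_pos hG1).ne')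
    have hGP : G ≤ P := hGk.trans (by rw [hP]; exact Nat.le_mul_of_pos_left _ hκ1)
    have hZeq : Z = P * S := by rw [hZ, hZf, hκ, hP]; simp only; ring
    set R := pcBound M + kw + 2 * N + 30 with hR
    have hSR : S = 2 * M.maxConst + R := by rw [hS, hR]; ring
    have hPS : P * S = P * (2 * M.maxConst) + P * R := by rw [hSR]; ring
    have hPe : 2 * M.maxConst ≤ P * (2 * M.maxConst) := Nat.le_mul_of_pos_left _ hP1
    have hPR : P * 30 ≤ P * R := Nat.mul_le_mul_left _ (by omega)
    -- `B G ≤ Z` for `B ≤ S`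
    have hBG : ∀ B, B ≤ S → B * G ≤ Z := fun B hB => by
      rw [hZeq, Nat.mul_comm P S]; exact Nat.mul_le_mul hB hGP
    have h1G := hBG 1 (by omega)
    have h6G := hBG 6 (by omega)
    have hSG := hBG S le_rfl
    have hN8G := hBG (N + 8) (by omega)
    have h2N7G := hBG (2 * N + 7) (by omega)
    have hZ1 : 1 ≤ Z := by omega
    have hTZ : (toksQ φ).length + 6 ≤ Z := by omega
    have hnZ : n + N + 8 ≤ Z := by
      have e : (N + 8) * G = (N + 8) * (G - 1) + (N + 8) := by
        rw [← Nat.mul_succ, Nat.succ_eq_add_one, Nat.sub_add_cancel hG1]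
      have : n ≤ (N + 8) * (G - 1) := le_trans (by omega) (Nat.le_mul_of_pos_left (G - 1) (by omega))
      omega
    have hSSG : S ≤ S * G := Nat.le_mul_of_pos_right S hG1
    have hkZ : kw + 1 ≤ Z := by omega
    have hPZ : pcBound M ≤ Z := by omega
    have hLZ : L ≤ Z := by omega
    -- the word size and the value bound
    set W := wszQ kw N φ with hW
    set V := valueBound M W with hV
    have hA : 6 + (dataWords (formulaOf φ)).length ≤ (toksQ φ).length + 6 := by
      have := length_dataWords_le (formulaOf φ); have := length_formulaToks_le_toksQ φ; omega
    have hbase : 2 * (6 + (dataWords (formulaOf φ)).length) + 4 * (n + N) + 2 ≤ (4 * N + 14) * G := by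
      have hm : (4 * N + 14) * (L + n + 1) ≤ (4 * N + 14) * G := Nat.mul_le_mul_left _ hGn
      have e : (4 * N + 14) * (L + n + 1) = (4 * N + 14) * L + (4 * N + 14) * n + (4 * N + 14) := by ring
      have hl : 14 * L ≤ (4 * N + 14) * L := Nat.mul_le_mul_right _ (by omega)
      have hn' : 14 * n ≤ (4 * N + 14) * n := Nat.mul_le_mul_right _ (by omega)
      omega
    have h2W : 2 ^ W ≤ P := by
      rw [hW, wszQ, hP, ← Nat.mul_pow]
      exact (two_pow_wsize_le _ _ _).trans (Nat.pow_le_pow_left hbase kw)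
    have hWZ : W ≤ Z := by
      rw [hW, wszQ]
      refine (wsize_le _ _ _).trans ?_
      rw [hZeq, Nat.mul_comm P S]
      refine Nat.mul_le_mul (by omega) (hbase.trans ?_)
      rw [hP]; exact Nat.mul_le_mul h4N hGk
    have hVb : V ≤ P + M.maxConst := (valueBound_le M W).trans (by omega)
    have hβZ : (encodeNat (2 * V + 2)).length ≤ Z := by
      have h1 := TM2Pass.length_encodeNat_le_self (2 * V + 2)
      rw [hZeq, hPS]; omega
    have hVZ : V + 2 ≤ Z := by rw [hZeq, hPS]; omega
    have hBZ : (encodeNat (bndQ N φ + 1)).length ≤ Z := by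
      have h1 := TM2Pass.length_encodeNat_le_self (bndQ N φ + 1)
      refine le_trans ?_ h2N7G
      have hm : (2 * N + 7) * (L + n + 1) ≤ (2 * N + 7) * G := Nat.mul_le_mul_left _ hGn
      have e : (2 * N + 7) * (L + n + 1) = (2 * N + 7) * L + (2 * N + 7) * n + (2 * N + 7) := by ring
      have hl : 7 * L ≤ (2 * N + 7) * L := Nat.mul_le_mul_right _ (by omega)
      have hn' : 7 * n ≤ (2 * N + 7) * n := Nat.mul_le_mul_right _ (by omega)
      unfold bndQ at h1 ⊢
      omega
    -- the two paths
    by_cases h0 : [] ∈ φ.clauses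
    · have hd : decide φ.Satisfiable = false := decide_eq_false (not_satisfiable_of_nil_mem φ h0)
      have hprog := runs_decideProgQ_nil_mem kw hN1 M φ h0
      rw [← hd] at hprog
      have h2 := machineQ_outputsWithin hprog
      have h3 := TM2ComputableAux.comp_outputsWithin Mr (machineQ kw N M) hrec h2
      refine h3.mono ?_
      have htot := total_nil_le (N := N) (n := n) (kw := kw) hZ1 hTZ hnZ hkZ hWZ hBZ hLZ
      have : 9100 * Z ^ 5 ≤ 9100 * Zf n L ^ 5 * (Nb n + 1) := by
        rw [← hZ]; exact Nat.le_mul_of_pos_right _ (Nat.succ_pos _)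
      exact le_trans htot this
    -- the RAM run on the padded clause list
    set x := encodeCNFWords (paddedN N φ) with hx
    have hnv : CNF.numVars (paddedN N φ) = n + N := numVars_paddedN hN1 φ
    have hsize : CNF.numClauses (paddedN N φ) + CNF.size (paddedN N φ) ≤ (CNF.numVars (paddedN N φ) + 1) ^ c := by
      refine (numClauses_add_size_paddedN_le φ hsp).trans ?_
      exact Nat.pow_le_pow_right (Nat.succ_pos _) hc
    obtain ⟨cfg, hhalt, hgood⟩ := hM (paddedN N φ) hsize
    rw [CNFSAT_good_iff] at hgood
    rw [hnv, ← wszQ_eq kw hN1 φ h0, ← hW] at hhalt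
    obtain ⟨ns, hns, hrun, hstep⟩ := hhalt.exists_run
    have hcf : cfg.pc = none := (step_eq_none_iff _ _ _ _ _).1 hstep
    have hm1 := mem_one_of_readOut_eq_singleton hgood
    have hb : cfg.mem 1 = 0 ∨ cfg.mem 1 = 1 := by rw [hm1]; split_ifs <;> simp
    have hd : decide (cfg.mem 1 = 1) = decide φ.Satisfiable := by
      rw [hm1]
      by_cases h : φ.Satisfiable
      · rw [if_pos ((satisfiable_paddedN_iff N φ).2 h), decide_eq_true h]; rfl
      · rw [if_neg (mt (satisfiable_paddedN_iff N φ).1 h), decide_eq_false h]; rfl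
    -- every word of the image fits in a word (`kw ≥ 1`)
    have hWi : inputWidth x ≤ W := by
      rw [hW, wszQ_eq kw hN1 φ h0, ← hx]
      exact Nat.le_mul_of_pos_left _ hkw
    have hxb : ∀ v ∈ x, v < 2 ^ W := fun v hv =>
      lt_of_lt_of_le (lt_two_pow_inputWidth_of_mem x v hv) (Nat.pow_le_pow_right (by norm_num) hWi)
    have hl : x.length < 2 ^ W := lt_of_lt_of_le (length_lt_two_pow_inputWidth x) (Nat.pow_le_pow_right (by norm_num) hWi)
    have hprog := runs_decideProgQ_run hN1 hO φ h0 hxb hl hrun hcf hb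
    rw [hd] at hprog
    have h2 := machineQ_outputsWithin hprog
    have h3 := TM2ComputableAux.comp_outputsWithin Mr (machineQ kw N M) hrec h2
    refine h3.mono ?_
    have htot := total_run_le (N := N) (n := n) (kw := kw) (ns := ns) hZ1 hTZ hnZ hkZ hWZ hβZ hVZ hPZ hLZ
    have hns' : ns + 1 ≤ Nb n + 1 := by rw [hNb]; exact Nat.succ_le_succ hns
    have : 9100 * Z ^ 5 * (ns + 1) ≤ 9100 * Zf n L ^ 5 * (Nb n + 1) := by rw [← hZ]; exact Nat.mul_le_mul_left _ hns'
    exact le_trans htot this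

end NSETHBridge

/-- The named fact, restated at top level: `sparseKSATInExpTime_of_cnfSATInThreeSumOracleRAMTime` holds.
[cite: CookReckhow1973, §2] -/
theorem sparseKSATInExpTime_of_cnfSATInThreeSumOracleRAMTime_holds :
    sparseKSATInExpTime_of_cnfSATInThreeSumOracleRAMTime :=
  NSETHBridge.sparseKSATInExpTime_of_cnfSATInThreeSumOracleRAMTime_holds

end Literature.Computability.FineGrained
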